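import Mathlib
import HarnessLib
import Summits.NavierStokesRegularity.NavierStokesRegularity.Theorems.UnthreadedDoorNetFluxDefs

/-!
# Route `UnthreadedDoor`, crux `PoloidalLiouville` (stmt-NavierStokesRegularity-1222), WALL W1 `stub_scalarLiouville` —
# crux idea «netflux-typei-gap» (ns-idea-14): NF-1a toolkit, sub-lemma (An3) — THE LAST-CROSSING LEMMA

NF-1a `stub_extremalHeadEMF` (hinge (a), the research stub of LINE v7 0e37b0e5ff94) is planned in ns-idea-14's toolkit
`Cruxes/PoloidalLiouville/Lines/netflux_typei_gap_nf1a_toolkit.lean` (d9acefb9e49a) as six typed sub-lemmas; this file proves the pure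
one-dimensional one, (An3) `stub_lastCrossing`, with the toolkit's binders VERBATIM:

> `Q` continuous on `[a,b]`, locally non-increasing to the right at every point of `[a,b) ∖ C`, `Q(C ∩ [a,b])` Lebesgue-null ⇒ `Q b ≤ Q a`.

PROOF (the «last crossing»): if `Q a < Q b`, every `y ∈ ]Q a, Q b[` is a value of `Q` on `C ∩ [a,b]`: the last point
`c_y := sup {c ∈ [a,b] : Q c ≤ y}` has `Q c_y = y` (closedness + continuity), `Q > y` to its right, hence cannot be a point of local
right-non-increase, so `c_y ∈ C`.  Thus `]Q a, Q b[ ⊆ Q(C ∩ [a,b])`, a null set of positive measure — contradiction.  (The closedness of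
`C` in the toolkit's binders is not needed; the binder is kept, underscored, so the toolkit's stub closes by name:
`theorem stub_lastCrossing Q hab C hC hQ hdec hnull := Theorems.PoloidalLiouville.NetFlux.NF1a.lastCrossing Q hab C hC hQ hdec hnull`.)
In the plan it is applied to `Q = G − L·(c − a)` on an interval of values of `f|_{S_r}`, `C` = critical values (Sard-null image).

WHAT THIS IS NOT: no NS-regularity statement is touched (1-D real analysis); SUPPORT for the line's NF-1a stub, which stays OPEN, as do
`PoloidalLiouville` (1222), W1, the rung target and the summit.  `--supports stmt-NavierStokesRegularity-1222 --as helper`.  [folklore]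
-/

noncomputable section

-- the summit and its single sub-problem share the name (CONVENTIONS §1)
set_option linter.dupNamespace false

open Set Function Filter Topology MeasureTheory

namespace Summit.NavierStokesRegularity.NavierStokesRegularity.Theorems.PoloidalLiouville.NetFlux.NF1a

/-- **The last-crossing lemma** (NF-1a toolkit (An3), binders verbatim): `Q` continuous on `[a,b]`, locally non-increasing to the right
at every point of `[a,b) ∖ C`, and `Q(C ∩ [a,b])` null ⇒ `Q b ≤ Q a`.  (Closedness of `C` is not used.) [folklore] -/
theorem lastCrossing (Q : ℝ → ℝ) {a b : ℝ} (hab : a ≤ b) (C : Set ℝ) (_hC : IsClosed C)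
    (hQ : ContinuousOn Q (Icc a b))
    (hdec : ∀ x ∈ Ico a b, x ∉ C → ∃ δ > 0, ∀ y ∈ Ioo x (x + δ), Q y ≤ Q x)
    (hnull : volume (Q '' (C ∩ Icc a b)) = 0) : Q b ≤ Q a := by
  by_contra hlt
  push Not at hlt
  -- every intermediate value is taken on `C ∩ [a,b]`
  have key : Ioo (Q a) (Q b) ⊆ Q '' (C ∩ Icc a b) := by
    intro y hy
    set S : Set ℝ := Icc a b ∩ Q ⁻¹' Iic y with hS
    have hSc : IsClosed S := hQ.preimage_isClosed_of_isClosed isClosed_Icc isClosed_Iic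
    have hSb : BddAbove S := ⟨b, fun c hc => hc.1.2⟩
    have haS : a ∈ S := ⟨left_mem_Icc.2 hab, hy.1.le⟩
    set c := sSup S with hcdef
    have hcS : c ∈ S := hSc.csSup_mem ⟨a, haS⟩ hSb
    have hcI : c ∈ Icc a b := hcS.1
    have hQc : Q c ≤ y := hcS.2
    -- to the right of `c` (inside `[a,b]`), `Q > y`
    have hright : ∀ x ∈ Icc a b, c < x → y < Q x := by
      intro x hx hcx
      by_contra hle
      push Not at hle
      have hxS : x ∈ S := ⟨hx, hle⟩
      exact absurd (le_csSup hSb hxS) (not_le.2 hcx)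
    have hcb : c < b := by
      rcases eq_or_lt_of_le hcI.2 with h | h
      · exact absurd (h ▸ hQc) (not_le.2 hy.2)
      · exact h
    -- `Q c = y`
    have hQcy : Q c = y := by
      refine le_antisymm hQc ?_
      by_contra hlt'
      push Not at hlt'
      have hev : ∀ᶠ x in 𝓝[Icc a b] c, Q x < y := (hQ c hcI).eventually (gt_mem_nhds hlt')
      rw [eventually_nhdsWithin_iff, Metric.eventually_nhds_iff] at hev
      obtain ⟨ε, hε, hball⟩ := hev
      set x : ℝ := min (c + ε / 2) b with hx
      have hxI : x ∈ Icc a b := ⟨le_min (by linarith [hcI.1]) hab |>.trans' le_rfl, min_le_right _ _⟩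
      have hcx : c < x := lt_min (by linarith) hcb
      have hxd : dist x c < ε := by
        rw [Real.dist_eq, abs_of_pos (by linarith)]
        linarith [min_le_left (c + ε / 2) b]
      have h1 : Q x < y := hball hxd hxI
      exact absurd h1 (not_lt.2 (hright x hxI hcx).le)
    -- `c ∈ C`: otherwise `Q ≤ Q c = y` just right of `c`
    have hcC : c ∈ C := by
      by_contra hcC
      obtain ⟨δ, hδ, hδQ⟩ := hdec c ⟨hcI.1, hcb⟩ hcC
      set x : ℝ := min (c + δ / 2) b with hx
      have hxI : x ∈ Icc a b := ⟨le_min (by linarith [hcI.1]) hab |>.trans' le_rfl, min_le_right _ _⟩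
      have hcx : c < x := lt_min (by linarith) hcb
      have hxδ : x ∈ Ioo c (c + δ) := ⟨hcx, lt_of_le_of_lt (min_le_left _ _) (by linarith)⟩
      have h1 : Q x ≤ Q c := hδQ x hxδ
      rw [hQcy] at h1
      exact absurd h1 (not_le.2 (hright x hxI hcx))
    exact ⟨c, ⟨hcC, hcI⟩, hQcy⟩
  -- a null set cannot contain a nontrivial interval
  have hpos : 0 < volume (Ioo (Q a) (Q b)) := by
    rw [Real.volume_Ioo]
    exact ENNReal.ofReal_pos.2 (by linarith)
  have hle := measure_mono (μ := volume) key
  rw [hnull] at hle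
  exact absurd hle (not_le.2 hpos)

end Summit.NavierStokesRegularity.NavierStokesRegularity.Theorems.PoloidalLiouville.NetFlux.NF1a

end
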